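import Summits.Ventures.CertifiedManyBodySolver.Downfold.BoxesHg1201ELadderK1Segments
import Summits.Ventures.CertifiedManyBodySolver.Downfold.BoxesHg1201EP10KinematicCoverN
import HarnessLib

/-!
# The U-direction ladder of Hg-1201, part 12: `U`-CELL CHAINS OF ANY LEVEL, READ ON THE LADDER — generic glue in the `U` slot, k-cell leaf closers
# (@0 M19b, M19, @10), per-cell slice ceilings, the generic rung reading, and the LEVEL-1 instance `[7/2, 17/4] · [17/4, 5] · [5, 7] · [7, 44/5]`

Venture CertifiedManyBodySolver, cell `pub/hubbard-downfold` (MO-S1 → S2 seam; D-0154 (1)(C) COVERAGE (ii) HgBa₂CuO₄₊δ «Hg-1201»), seat `hubbard-cov-hg1201-unc-1`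
(lane U MEMBERS + QUOTIENT; rulings R-ma / R-mb (b) / R-mc (a)(b) / R-me (a)); namespace `Summit.Ventures.CertifiedManyBodySolver.Downfold`. Parts 1–11 of this
lane: `BoxesHg1201ULadder` (p607319) … `BoxesHg1201ELadderK1Segments` (part 11, p623609). Numbers: `router/BOXES/HgBa2CuO4.md` §OF-RECORD v1.14 (sha16
`89ad6cc9baa3f827` after lit-2's ADD-ONLY §LIT-PREVIEW v1.6 addendum, which moved box lines ≥ 55 by +3 and touched NO `U` / `U/t` / object-M row).

THE OBJECT. Part 11 typed the K1 left edge of route `CovHg1201M19b` (stmt-Ventures-26186 «PatchLeftEdge») at LEVEL 0 — the BC3 split `[7/2, 5] ∪ [5, 44/5]`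
through unc-2's two fixed slab boxes. At 10:08:20Z (obs STATUS l.2727 (a)) the captain wrote, BEFORE the first pinned print, that the level-0 pinned pairs are
EXPECTED to fail (spacing law `L ∝ ΔU^1.4`) and that the left edge is to close from FOUR `U`-cells `[7/2, 17/4] · [17/4, 5] · [5, 7] · [7, 44/5]` × `[179/200, 183/200]`
(level 1; legs A17o4 j305473 / A7 j305469), asking box-1 for a k-cell ITEM closer «breakpoints as parameters, or a list fold». This file is the DOWNFOLD-side
twin, LEVEL-FREE: whatever chain of `U`-cells finally certifies, the leaf and the rung-by-rung reading follow by name.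

* §G1 GENERIC GLUE IN THE `U` SLOT of the strip shape `∀ tp ∈ S, ∀ U ∈ Icc a m, ∀ n ∈ N, ObsStiffnessSeqCeilingAt tp U n c₁` (+ the same on `Icc m b`, `c₂`) ⇒ the shape
  on `Icc a b` with any `c ≥ c₁, c₂` — ANY split value `m` (no order hypothesis), any `S`, `N`; restriction; chains of 3 and 4.
* §G2 LEAF CLOSERS FROM CELL CHAINS, one certified constant `≤ bar` PER CELL: @0 M19b (`bar = 5166800/10⁷`, strip `[−27/50, −13/25] × U × [179/200, 183/200]`, box-2
  `Hg1201M19b_StiffnessBoxCeiling_of_cornerStrip`): two cells at any `m` (part 11's `m = 5` is the instance), three, four (`m₁ m₂ m₃ : ℝ` free), and BY NAME the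
  captain's LEVEL 1 `(17/4, 5, 7)`; M19 twins (patch `n ∈ [67/80, 22/25]`, `bar′ = 5084577/10⁷`); @10 twins (strip `[−49/100, −47/100] × U × [43/50, 22/25]`,
  `bar″ = 4767609/10⁷`, `U ∈ [3, 17/2]`; captain HANDOFF step 3 «vertices U ∈ {3, 5?, 17/2}»).
* §G3 PER-CELL SLICE CEILINGS AND THE GENERIC RUNG READING: a strip certificate on ONE cell `[lo, hi]` (any `lo ≤ hi : ℚ`) ⇒ `StiffnessBoxCeilingBelow
  (boxHg1201E_M19b.withEntry U [lo, hi]) bar` (box-2's `U`-parametric cover + unc-2's generic slice word); slice glue; WHAT ONE CELL CERTIFIES ON THE LADDER: every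
  object-E point with `lo ≤ U/t_eff ≤ hi` — member `m` eV on `t_eff ∈ [m/hi, m/lo] ∩ [1/2, 3/5]` — and every `U ∈ [3·lo/5, hi/2]` eV at EVERY `t_eff`
  (`hg1201E_Ucell_Ureach_iff`; non-empty iff `6·lo ≤ 5·hi`).
* §G4 THE LEVEL-1 LADDER CENSUS (numbers only; 16 members of parts 1/5): breakpoint `u` cuts member `m`'s @0 image `[5m/3, 2m]` iff `u/2 < m < 3u/5` iff
  `t* = m/u ∈ (1/2, 3/5)`: `u = 17/4` cuts Jang `2.15` (`t* = 43/85`); `u = 5` cuts the 3 straddlers (part 11); `u = 7` cuts EIGHT members `{3.7, 3.85, 3.85, 3.9, 3.99,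
  3.999, 4.0, 4.029}` (`t* = m/7 ∈ [37/70, 4029/7000]`); whole row in ONE cell: `[5, 7] ∋` in-house (D) `3.335`, Nilsson `3.42`; `[7, 44/5] ∋` cGW `4.37`; the two
  lower cells hold no whole row (full-`t` reaches `[21/10, 17/8]` / EMPTY, `6·17/4 > 5·5`); mRPA@QSGW `5.2` above (sliver `t ≥ 13/22` in `[7, 44/5]`): `1+3+8+2+1+1 = 16`.
* §G5 THE LEVEL-1 READINGS, CELL BY CELL, and all four ⇒ every rung (via part 7's `hg1201E_ladder_stiffness_of_rungLeaf`).
Everything here is PROVED (no `sorry`, no new axiom). HONEST FRAMING: every stiffness statement is a one-sided CEILING (CONTROL/CALIBRATION, wording class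
(xx1)), CONDITIONAL on strip-certificate hypotheses that do NOT exist at this writing; the cell chain is the captain's / PEN's instrument, not proposed here;
item and stub files of 26186/26187 are box-1's (captain RULING obs l.2729), untouched; typing certifies containment arithmetic of SCREENING-GRADE / [float]
members typed verbatim in parts 1–5 — nothing about HgBa₂CuO₄₊δ; no row / hull / bar / word of record is touched; no `T_c`, phase or `dT_c/dP` sentence; no
summit statement is proved by this file.
-/

noncomputable section

namespace Summit.Ventures.CertifiedManyBodySolver.Downfold

open Set NonemptyInterval
open Summit.Ventures.CertifiedManyBodySolver.Observables
open Literature.MathematicalPhysics.QuantumLattice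

/-! ## §G1 Generic glue in the `U` slot of the strip shape (any split value, any `t′`-set, any `n`-set) -/

/-- **GLUE TWO `U`-ADJACENT STRIP CERTIFICATES** (curried strip shape; ANY split value `m`, no order hypothesis; the constants are lifted to any common
`c ≥ c₁, c₂`): certificates on `U ∈ [a, m]` and on `U ∈ [m, b]` give one on `U ∈ [a, b]`. [cite: Neumaier2004CompleteSearch, §11] -/
theorem obsStiffnessStrip_glueU {S N : Set ℝ} {a m b : ℝ} {c₁ c₂ c : ℚ} (h₁c : c₁ ≤ c) (h₂c : c₂ ≤ c)
    (h₁ : ∀ tp ∈ S, ∀ U ∈ Icc a m, ∀ n ∈ N, ObsStiffnessSeqCeilingAt tp U n c₁)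
    (h₂ : ∀ tp ∈ S, ∀ U ∈ Icc m b, ∀ n ∈ N, ObsStiffnessSeqCeilingAt tp U n c₂) :
    ∀ tp ∈ S, ∀ U ∈ Icc a b, ∀ n ∈ N, ObsStiffnessSeqCeilingAt tp U n c := by
  intro tp htp U hU n hn
  rcases le_total U m with hm | hm
  · exact (h₁ tp htp U ⟨hU.1, hm⟩ n hn).mono h₁c
  · exact (h₂ tp htp U ⟨hm, hU.2⟩ n hn).mono h₂c

/-- **RESTRICT a strip certificate to a sub-cell** `[a′, b′] ⊆ [a, b]` (and lift the constant). [cite: Neumaier2004CompleteSearch, §11] -/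
theorem obsStiffnessStrip_monoU {S N : Set ℝ} {a b a' b' : ℝ} {c c' : ℚ} (hcc : c ≤ c') (ha : a ≤ a') (hb : b' ≤ b)
    (h : ∀ tp ∈ S, ∀ U ∈ Icc a b, ∀ n ∈ N, ObsStiffnessSeqCeilingAt tp U n c) :
    ∀ tp ∈ S, ∀ U ∈ Icc a' b', ∀ n ∈ N, ObsStiffnessSeqCeilingAt tp U n c' :=
  fun tp htp U hU n hn => (h tp htp U ⟨ha.trans hU.1, hU.2.trans hb⟩ n hn).mono hcc

/-- **THREE-CELL CHAIN** `[a, m₁] · [m₁, m₂] · [m₂, b]` ⇒ `[a, b]` (constants lifted to a common `c`). [cite: Neumaier2004CompleteSearch, §11] -/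
theorem obsStiffnessStrip_glueU3 {S N : Set ℝ} {a m₁ m₂ b : ℝ} {c₁ c₂ c₃ c : ℚ} (h₁c : c₁ ≤ c) (h₂c : c₂ ≤ c) (h₃c : c₃ ≤ c)
    (h₁ : ∀ tp ∈ S, ∀ U ∈ Icc a m₁, ∀ n ∈ N, ObsStiffnessSeqCeilingAt tp U n c₁)
    (h₂ : ∀ tp ∈ S, ∀ U ∈ Icc m₁ m₂, ∀ n ∈ N, ObsStiffnessSeqCeilingAt tp U n c₂)
    (h₃ : ∀ tp ∈ S, ∀ U ∈ Icc m₂ b, ∀ n ∈ N, ObsStiffnessSeqCeilingAt tp U n c₃) :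
    ∀ tp ∈ S, ∀ U ∈ Icc a b, ∀ n ∈ N, ObsStiffnessSeqCeilingAt tp U n c :=
  obsStiffnessStrip_glueU le_rfl h₃c (obsStiffnessStrip_glueU h₁c h₂c h₁ h₂) h₃

/-- **FOUR-CELL CHAIN** `[a, m₁] · [m₁, m₂] · [m₂, m₃] · [m₃, b]` ⇒ `[a, b]` (the captain's level-1 shape, breakpoints as parameters).
[cite: Neumaier2004CompleteSearch, §11] -/
theorem obsStiffnessStrip_glueU4 {S N : Set ℝ} {a m₁ m₂ m₃ b : ℝ} {c₁ c₂ c₃ c₄ c : ℚ} (h₁c : c₁ ≤ c) (h₂c : c₂ ≤ c) (h₃c : c₃ ≤ c) (h₄c : c₄ ≤ c)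
    (h₁ : ∀ tp ∈ S, ∀ U ∈ Icc a m₁, ∀ n ∈ N, ObsStiffnessSeqCeilingAt tp U n c₁)
    (h₂ : ∀ tp ∈ S, ∀ U ∈ Icc m₁ m₂, ∀ n ∈ N, ObsStiffnessSeqCeilingAt tp U n c₂)
    (h₃ : ∀ tp ∈ S, ∀ U ∈ Icc m₂ m₃, ∀ n ∈ N, ObsStiffnessSeqCeilingAt tp U n c₃)
    (h₄ : ∀ tp ∈ S, ∀ U ∈ Icc m₃ b, ∀ n ∈ N, ObsStiffnessSeqCeilingAt tp U n c₄) :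
    ∀ tp ∈ S, ∀ U ∈ Icc a b, ∀ n ∈ N, ObsStiffnessSeqCeilingAt tp U n c :=
  obsStiffnessStrip_glueU le_rfl h₄c (obsStiffnessStrip_glueU3 h₁c h₂c h₃c h₁ h₂ h₃) h₄

/-! ## §G2 Leaf closers from cell chains — @0 M19b, M19, @10 -/

/-- **@0 M19b LEAF FROM TWO `U`-CELLS AT ANY SPLIT `m`** (each cell its own certified constant `≤ 0.5166800` on the strip
`[−27/50, −13/25] × U × [179/200, 183/200]`; part 11's `Hg1201M19b_StiffnessBoxCeiling_of_twoSegmentStrips` is `m = 5`). CONDITIONAL.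
[cite: ScalapinoWhiteZhang1993, §II] -/
theorem Hg1201M19b_StiffnessBoxCeiling_of_twoCellStrips {m : ℝ} {c₁ c₂ : ℚ} (hc₁ : c₁ ≤ 5166800 / 10000000) (hc₂ : c₂ ≤ 5166800 / 10000000)
    (h₁ : ∀ tp ∈ Icc (-27 / 50 : ℝ) (-13 / 25), ∀ U ∈ Icc (7 / 2 : ℝ) m, ∀ n ∈ Icc (179 / 200 : ℝ) (183 / 200), ObsStiffnessSeqCeilingAt tp U n c₁)
    (h₂ : ∀ tp ∈ Icc (-27 / 50 : ℝ) (-13 / 25), ∀ U ∈ Icc m (44 / 5), ∀ n ∈ Icc (179 / 200 : ℝ) (183 / 200), ObsStiffnessSeqCeilingAt tp U n c₂) :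
    Hg1201M19b_StiffnessBoxCeiling :=
  Hg1201M19b_StiffnessBoxCeiling_of_cornerStrip le_rfl (obsStiffnessStrip_glueU hc₁ hc₂ h₁ h₂)

/-- **@0 M19b LEAF FROM THREE `U`-CELLS** (breakpoints `m₁ m₂` free). CONDITIONAL. [cite: ScalapinoWhiteZhang1993, §II] -/
theorem Hg1201M19b_StiffnessBoxCeiling_of_threeCellStrips {m₁ m₂ : ℝ} {c₁ c₂ c₃ : ℚ} (hc₁ : c₁ ≤ 5166800 / 10000000) (hc₂ : c₂ ≤ 5166800 / 10000000)
    (hc₃ : c₃ ≤ 5166800 / 10000000)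
    (h₁ : ∀ tp ∈ Icc (-27 / 50 : ℝ) (-13 / 25), ∀ U ∈ Icc (7 / 2 : ℝ) m₁, ∀ n ∈ Icc (179 / 200 : ℝ) (183 / 200), ObsStiffnessSeqCeilingAt tp U n c₁)
    (h₂ : ∀ tp ∈ Icc (-27 / 50 : ℝ) (-13 / 25), ∀ U ∈ Icc m₁ m₂, ∀ n ∈ Icc (179 / 200 : ℝ) (183 / 200), ObsStiffnessSeqCeilingAt tp U n c₂)
    (h₃ : ∀ tp ∈ Icc (-27 / 50 : ℝ) (-13 / 25), ∀ U ∈ Icc m₂ (44 / 5), ∀ n ∈ Icc (179 / 200 : ℝ) (183 / 200), ObsStiffnessSeqCeilingAt tp U n c₃) :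
    Hg1201M19b_StiffnessBoxCeiling :=
  Hg1201M19b_StiffnessBoxCeiling_of_cornerStrip le_rfl (obsStiffnessStrip_glueU3 hc₁ hc₂ hc₃ h₁ h₂ h₃)

/-- **@0 M19b LEAF FROM FOUR `U`-CELLS** `[7/2, m₁] · [m₁, m₂] · [m₂, m₃] · [m₃, 44/5]` (breakpoints free; the captain's level-1 SHAPE, obs STATUS l.2727 (a)).
CONDITIONAL. [cite: ScalapinoWhiteZhang1993, §II] -/
theorem Hg1201M19b_StiffnessBoxCeiling_of_fourCellStrips {m₁ m₂ m₃ : ℝ} {c₁ c₂ c₃ c₄ : ℚ} (hc₁ : c₁ ≤ 5166800 / 10000000) (hc₂ : c₂ ≤ 5166800 / 10000000)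
    (hc₃ : c₃ ≤ 5166800 / 10000000) (hc₄ : c₄ ≤ 5166800 / 10000000)
    (h₁ : ∀ tp ∈ Icc (-27 / 50 : ℝ) (-13 / 25), ∀ U ∈ Icc (7 / 2 : ℝ) m₁, ∀ n ∈ Icc (179 / 200 : ℝ) (183 / 200), ObsStiffnessSeqCeilingAt tp U n c₁)
    (h₂ : ∀ tp ∈ Icc (-27 / 50 : ℝ) (-13 / 25), ∀ U ∈ Icc m₁ m₂, ∀ n ∈ Icc (179 / 200 : ℝ) (183 / 200), ObsStiffnessSeqCeilingAt tp U n c₂)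
    (h₃ : ∀ tp ∈ Icc (-27 / 50 : ℝ) (-13 / 25), ∀ U ∈ Icc m₂ m₃, ∀ n ∈ Icc (179 / 200 : ℝ) (183 / 200), ObsStiffnessSeqCeilingAt tp U n c₃)
    (h₄ : ∀ tp ∈ Icc (-27 / 50 : ℝ) (-13 / 25), ∀ U ∈ Icc m₃ (44 / 5), ∀ n ∈ Icc (179 / 200 : ℝ) (183 / 200), ObsStiffnessSeqCeilingAt tp U n c₄) :
    Hg1201M19b_StiffnessBoxCeiling :=
  Hg1201M19b_StiffnessBoxCeiling_of_cornerStrip le_rfl (obsStiffnessStrip_glueU4 hc₁ hc₂ hc₃ hc₄ h₁ h₂ h₃ h₄)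

/-- **THE CAPTAIN'S LEVEL 1 BY NAME**: strip certificates on the four cells `[7/2, 17/4] · [17/4, 5] · [5, 7] · [7, 44/5]` × `[−27/50, −13/25]` × `[179/200, 183/200]`,
each with its own `cᵢ ≤ 0.5166800`, give the rung leaf «MOS2-hg1201-M19b». CONDITIONAL (legs A17o4 / A7 queued at this writing). [cite: ScalapinoWhiteZhang1993, §II] -/
theorem Hg1201M19b_StiffnessBoxCeiling_of_level1Strips {c₁ c₂ c₃ c₄ : ℚ} (hc₁ : c₁ ≤ 5166800 / 10000000)
    (hc₂ : c₂ ≤ 5166800 / 10000000) (hc₃ : c₃ ≤ 5166800 / 10000000) (hc₄ : c₄ ≤ 5166800 / 10000000)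
    (h₁ : ∀ tp ∈ Icc (-27 / 50 : ℝ) (-13 / 25), ∀ U ∈ Icc (7 / 2 : ℝ) (17 / 4), ∀ n ∈ Icc (179 / 200 : ℝ) (183 / 200), ObsStiffnessSeqCeilingAt tp U n c₁)
    (h₂ : ∀ tp ∈ Icc (-27 / 50 : ℝ) (-13 / 25), ∀ U ∈ Icc (17 / 4 : ℝ) 5, ∀ n ∈ Icc (179 / 200 : ℝ) (183 / 200), ObsStiffnessSeqCeilingAt tp U n c₂)
    (h₃ : ∀ tp ∈ Icc (-27 / 50 : ℝ) (-13 / 25), ∀ U ∈ Icc (5 : ℝ) 7, ∀ n ∈ Icc (179 / 200 : ℝ) (183 / 200), ObsStiffnessSeqCeilingAt tp U n c₃)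
    (h₄ : ∀ tp ∈ Icc (-27 / 50 : ℝ) (-13 / 25), ∀ U ∈ Icc (7 : ℝ) (44 / 5), ∀ n ∈ Icc (179 / 200 : ℝ) (183 / 200), ObsStiffnessSeqCeilingAt tp U n c₄) :
    Hg1201M19b_StiffnessBoxCeiling :=
  Hg1201M19b_StiffnessBoxCeiling_of_fourCellStrips hc₁ hc₂ hc₃ hc₄ h₁ h₂ h₃ h₄

/-- **M19 (optimal doping, bar `0.5084577`, patch `[−27/50, −13/25] × U × [67/80, 22/25]`) LEAF FROM TWO / FOUR `U`-CELLS** (breakpoints free).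
CONDITIONAL. [cite: ScalapinoWhiteZhang1993, §II] -/
theorem Hg1201M19_StiffnessBoxCeiling_of_cellPatches {m m₁ m₂ m₃ : ℝ} {c₁ c₂ c₃ c₄ : ℚ} (hc₁ : c₁ ≤ 5084577 / 10000000)
    (hc₂ : c₂ ≤ 5084577 / 10000000) (hc₃ : c₃ ≤ 5084577 / 10000000) (hc₄ : c₄ ≤ 5084577 / 10000000) :
    ((∀ tp ∈ Icc (-27 / 50 : ℝ) (-13 / 25), ∀ U ∈ Icc (7 / 2 : ℝ) m, ∀ n ∈ Icc (67 / 80 : ℝ) (22 / 25), ObsStiffnessSeqCeilingAt tp U n c₁) →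
      (∀ tp ∈ Icc (-27 / 50 : ℝ) (-13 / 25), ∀ U ∈ Icc m (44 / 5), ∀ n ∈ Icc (67 / 80 : ℝ) (22 / 25), ObsStiffnessSeqCeilingAt tp U n c₂) →
      Hg1201M19_StiffnessBoxCeiling) ∧
    ((∀ tp ∈ Icc (-27 / 50 : ℝ) (-13 / 25), ∀ U ∈ Icc (7 / 2 : ℝ) m₁, ∀ n ∈ Icc (67 / 80 : ℝ) (22 / 25), ObsStiffnessSeqCeilingAt tp U n c₁) →
      (∀ tp ∈ Icc (-27 / 50 : ℝ) (-13 / 25), ∀ U ∈ Icc m₁ m₂, ∀ n ∈ Icc (67 / 80 : ℝ) (22 / 25), ObsStiffnessSeqCeilingAt tp U n c₂) →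
      (∀ tp ∈ Icc (-27 / 50 : ℝ) (-13 / 25), ∀ U ∈ Icc m₂ m₃, ∀ n ∈ Icc (67 / 80 : ℝ) (22 / 25), ObsStiffnessSeqCeilingAt tp U n c₃) →
      (∀ tp ∈ Icc (-27 / 50 : ℝ) (-13 / 25), ∀ U ∈ Icc m₃ (44 / 5), ∀ n ∈ Icc (67 / 80 : ℝ) (22 / 25), ObsStiffnessSeqCeilingAt tp U n c₄) →
      Hg1201M19_StiffnessBoxCeiling) :=
  ⟨fun h₁ h₂ => Hg1201M19_StiffnessBoxCeiling_of_cornerPatch le_rfl (obsStiffnessStrip_glueU hc₁ hc₂ h₁ h₂),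
    fun h₁ h₂ h₃ h₄ => Hg1201M19_StiffnessBoxCeiling_of_cornerPatch le_rfl (obsStiffnessStrip_glueU4 hc₁ hc₂ hc₃ hc₄ h₁ h₂ h₃ h₄)⟩

/-- **@10 (M19P10, bar `0.4767609`, strip `[−49/100, −47/100] × U × [43/50, 22/25]`, `U ∈ [3, 17/2]`) LEAF FROM TWO / THREE `U`-CELLS** (breakpoints free;
the captain's step 3 names vertices `U ∈ {3, 5?, 17/2}` ⇒ `m = 5` would be the first split). CONDITIONAL. [cite: ScalapinoWhiteZhang1993, §II] -/
theorem Hg1201M19P10_StiffnessBoxCeiling_of_cellStrips {m m₁ m₂ : ℝ} {c₁ c₂ c₃ : ℚ} (hc₁ : c₁ ≤ 4767609 / 10000000)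
    (hc₂ : c₂ ≤ 4767609 / 10000000) (hc₃ : c₃ ≤ 4767609 / 10000000) :
    ((∀ tp ∈ Icc (-49 / 100 : ℝ) (-47 / 100), ∀ U ∈ Icc (3 : ℝ) m, ∀ n ∈ Icc (43 / 50 : ℝ) (22 / 25), ObsStiffnessSeqCeilingAt tp U n c₁) →
      (∀ tp ∈ Icc (-49 / 100 : ℝ) (-47 / 100), ∀ U ∈ Icc m (17 / 2), ∀ n ∈ Icc (43 / 50 : ℝ) (22 / 25), ObsStiffnessSeqCeilingAt tp U n c₂) →
      Hg1201M19P10_StiffnessBoxCeiling) ∧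
    ((∀ tp ∈ Icc (-49 / 100 : ℝ) (-47 / 100), ∀ U ∈ Icc (3 : ℝ) m₁, ∀ n ∈ Icc (43 / 50 : ℝ) (22 / 25), ObsStiffnessSeqCeilingAt tp U n c₁) →
      (∀ tp ∈ Icc (-49 / 100 : ℝ) (-47 / 100), ∀ U ∈ Icc m₁ m₂, ∀ n ∈ Icc (43 / 50 : ℝ) (22 / 25), ObsStiffnessSeqCeilingAt tp U n c₂) →
      (∀ tp ∈ Icc (-49 / 100 : ℝ) (-47 / 100), ∀ U ∈ Icc m₂ (17 / 2), ∀ n ∈ Icc (43 / 50 : ℝ) (22 / 25), ObsStiffnessSeqCeilingAt tp U n c₃) →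
      Hg1201M19P10_StiffnessBoxCeiling) :=
  ⟨fun h₁ h₂ => Hg1201M19P10_StiffnessBoxCeiling_of_cornerStrip le_rfl (obsStiffnessStrip_glueU hc₁ hc₂ h₁ h₂),
    fun h₁ h₂ h₃ => Hg1201M19P10_StiffnessBoxCeiling_of_cornerStrip le_rfl (obsStiffnessStrip_glueU3 hc₁ hc₂ hc₃ h₁ h₂ h₃)⟩

/-! ## §G3 Per-cell slice ceilings and the generic rung reading (@0 M19b entries) -/

/-- **ONE CELL'S STRIP CERTIFICATE ⇒ THE SLICE CEILING** on `boxHg1201E_M19b.withEntry U [lo, hi]` (any `lo ≤ hi : ℚ`, inward or not; box-2's `U`-parametric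
strip cover `hg1201M19b_cell_of_cornerStrip` + unc-2's generic slice word). The interim object when some cells have landed and others not. CONDITIONAL.
[cite: ScalapinoWhiteZhang1993, §II] [cite: HazraVermaRanderia2019, eqs. (2)-(6)] -/
theorem stiffnessBoxCeilingBelow_M19bUcell_of_cornerStrip {lo hi : ℚ} (hle : lo ≤ hi) {c : ℚ} (hc : c ≤ 5166800 / 10000000)
    (h : ∀ tp ∈ Icc (-27 / 50 : ℝ) (-13 / 25), ∀ U ∈ Icc (lo : ℝ) hi, ∀ n ∈ Icc (179 / 200 : ℝ) (183 / 200), ObsStiffnessSeqCeilingAt tp U n c) :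
    StiffnessBoxCeilingBelow (boxHg1201E_M19b.withEntry .UOverT (Entry.ofEnds lo hi hle .screening)) (5166800 / 10000000) :=
  stiffnessBoxCeilingBelow_of_holdsOn le_rfl (boxHg1201E_M19b_sliceU_stiffnessWord_of_cellLeaf hle (hg1201M19b_cell_of_cornerStrip hc h))

/-- **SLICE GLUE** (generic word `W`): words on the slices `[a, m]` and `[m, b]` of M19b give the word on the slice `[a, b]`. [folklore] -/
theorem holdsOn_M19bUslices_glue {W : (OneBandCoord → ℝ) → Prop} {a m b : ℚ} (ham : a ≤ m) (hmb : m ≤ b)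
    (h₁ : HoldsOn W (boxHg1201E_M19b.withEntry .UOverT (Entry.ofEnds a m ham .screening)))
    (h₂ : HoldsOn W (boxHg1201E_M19b.withEntry .UOverT (Entry.ofEnds m b hmb .screening))) :
    HoldsOn W (boxHg1201E_M19b.withEntry .UOverT (Entry.ofEnds a b (ham.trans hmb) .screening)) := by
  intro p hp
  obtain ⟨⟨hU1, hU2⟩, hrest⟩ := (boxHg1201E_M19b_sliceU_mem_iff _ p).1 hp
  rcases le_total (p .UOverT) ((m : ℚ) : ℝ) with hm | hm
  · exact h₁ p ((boxHg1201E_M19b_sliceU_mem_iff ham p).2 ⟨⟨hU1, hm⟩, hrest⟩)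
  · exact h₂ p ((boxHg1201E_M19b_sliceU_mem_iff hmb p).2 ⟨⟨hm, hU2⟩, hrest⟩)

/-- **SLICE CEILINGS GLUE** (each slice its own constant below the bar; the glued slice takes the larger). [cite: ScalapinoWhiteZhang1993, §II] -/
theorem stiffnessBoxCeilingBelow_M19bUslices_glue {a m b bar : ℚ} (ham : a ≤ m) (hmb : m ≤ b)
    (h₁ : StiffnessBoxCeilingBelow (boxHg1201E_M19b.withEntry .UOverT (Entry.ofEnds a m ham .screening)) bar)
    (h₂ : StiffnessBoxCeilingBelow (boxHg1201E_M19b.withEntry .UOverT (Entry.ofEnds m b hmb .screening)) bar) :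
    StiffnessBoxCeilingBelow (boxHg1201E_M19b.withEntry .UOverT (Entry.ofEnds a b (ham.trans hmb) .screening)) bar := by
  obtain ⟨⟨c₁, hc₁, hW₁⟩, ⟨c₂, hc₂, hW₂⟩⟩ := And.intro h₁ h₂
  exact ⟨max c₁ c₂, max_le hc₁ hc₂, holdsOn_M19bUslices_glue ham hmb (fun p hp => (hW₁ p hp).mono (le_max_left _ _))
    (fun p hp => (hW₂ p hp).mono (le_max_right _ _))⟩

/-- **THE GENERIC RUNG READING** (quotient form): a ceiling on the cell `[lo, hi]` certifies ONE `c ≤ bar` at every object-E point with `lo ≤ U/t_eff ≤ hi` and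
`t_eff`, `t′/t_eff`, `n` in M19b's entries. CONDITIONAL on the slice ceiling. [cite: ScalapinoWhiteZhang1993, §II] -/
theorem hg1201E_Ucell_rungs_of_ceiling {lo hi : ℚ} (hle : lo ≤ hi) {bar : ℚ}
    (h : StiffnessBoxCeilingBelow (boxHg1201E_M19b.withEntry .UOverT (Entry.ofEnds lo hi hle .screening)) bar) :
    ∃ c : ℚ, c ≤ bar ∧ ∀ U t tp n : ℝ, ((lo : ℝ) ≤ U / t ∧ U / t ≤ hi) → hg1201E_M19b_t.Mem t → hg1201E_M19b_tp.Mem tp →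
      hg1201E_M19b_n.Mem n → ObsStiffnessSeqCeilingAt tp (U / t) n c := by
  obtain ⟨c, hc, hW⟩ := h
  exact ⟨c, hc, fun U t tp n hUt ht htp hn => stiffnessWord_apply_oneBandPointE hW (oneBandPointE_mem_M19b_sliceU hle hUt htp hn ht)⟩

/-- **THE GENERIC RUNG READING** (eV form): the same at every `(U, t_eff)` with `lo·t_eff ≤ U ≤ hi·t_eff` — i.e. the admitted member `m` eV is covered on
`t_eff ∈ [m/hi, m/lo] ∩ [1/2, 3/5]`. CONDITIONAL. [cite: ScalapinoWhiteZhang1993, §II] -/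
theorem hg1201E_Ucell_rungs_of_ceiling' {lo hi : ℚ} (hle : lo ≤ hi) {bar : ℚ}
    (h : StiffnessBoxCeilingBelow (boxHg1201E_M19b.withEntry .UOverT (Entry.ofEnds lo hi hle .screening)) bar) :
    ∃ c : ℚ, c ≤ bar ∧ ∀ U t tp n : ℝ, ((lo : ℝ) * t ≤ U ∧ U ≤ hi * t) → hg1201E_M19b_t.Mem t → hg1201E_M19b_tp.Mem tp →
      hg1201E_M19b_n.Mem n → ObsStiffnessSeqCeilingAt tp (U / t) n c := by
  obtain ⟨c, hc, hW⟩ := hg1201E_Ucell_rungs_of_ceiling hle h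
  refine ⟨c, hc, fun U t tp n hU ht htp hn => hW U t tp n ?_ ht htp hn⟩
  have ht' := (Entry.mem_ofEnds_iff _ _ _ _ _).1 ht; push_cast at ht'
  have ht0 : (0 : ℝ) < t := by linarith [ht'.1]
  exact ⟨by rw [le_div_iff₀ ht0]; linarith [hU.1], by rw [div_le_iff₀ ht0]; linarith [hU.2]⟩

/-- **A CELL'S EXACT FULL-`t_eff` REACH ON THE eV AXIS** (generic `0 ≤ lo`): `U/t ∈ [lo, hi]` for EVERY `t_eff ∈ [1/2, 3/5]` iff `3·lo/5 ≤ U ≤ hi/2`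
(non-empty iff `6·lo ≤ 5·hi`; parts 10/11's `[7/2, 44/5] ↦ [21/10, 22/5]`, `[7/2, 5] ↦ [21/10, 5/2]`, `[5, 44/5] ↦ [3, 22/5]` are instances). [folklore] -/
theorem hg1201E_Ucell_Ureach_iff {lo hi : ℚ} (hlo : 0 ≤ lo) {U : ℝ} :
    (∀ t : ℝ, (1 / 2 : ℝ) ≤ t ∧ t ≤ 3 / 5 → (lo : ℝ) ≤ U / t ∧ U / t ≤ hi) ↔ ((3 : ℝ) / 5 * lo ≤ U ∧ U ≤ hi / 2) := by
  have hlo' : (0 : ℝ) ≤ (lo : ℝ) := by exact_mod_cast hlo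
  constructor
  · intro h
    have h1 := (h (3 / 5) ⟨by norm_num, by norm_num⟩).1; rw [le_div_iff₀ (by norm_num : (0 : ℝ) < 3 / 5)] at h1
    have h2 := (h (1 / 2) ⟨by norm_num, by norm_num⟩).2; rw [div_le_iff₀ (by norm_num : (0 : ℝ) < 1 / 2)] at h2
    constructor <;> linarith
  · rintro ⟨h1, h2⟩ t ht
    have ht0 : (0 : ℝ) < t := by linarith [ht.1]
    have hhi : (0 : ℝ) ≤ (hi : ℝ) := by linarith
    constructor; · rw [le_div_iff₀ ht0]; nlinarith [mul_nonneg hlo' (sub_nonneg.2 ht.2)]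
    · rw [div_le_iff₀ ht0]; nlinarith [mul_nonneg hhi (sub_nonneg.2 ht.1)]

/-- **FULL-`t_eff` READING OF ONE CELL**: a cell-`[lo, hi]` ceiling (`0 ≤ lo`) certifies every `U ∈ [3·lo/5, hi/2]` eV at EVERY `t_eff ∈ [1/2, 3/5]` over the M19b
`t′/t`, `n` entries. CONDITIONAL. [cite: ScalapinoWhiteZhang1993, §II] -/
theorem hg1201E_Ucell_fullReach_of_ceiling {lo hi : ℚ} (hle : lo ≤ hi) (hlo : 0 ≤ lo) {bar : ℚ}
    (h : StiffnessBoxCeilingBelow (boxHg1201E_M19b.withEntry .UOverT (Entry.ofEnds lo hi hle .screening)) bar) :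
    ∃ c : ℚ, c ≤ bar ∧ ∀ U t tp n : ℝ, ((3 : ℝ) / 5 * lo ≤ U ∧ U ≤ hi / 2) → hg1201E_M19b_t.Mem t → hg1201E_M19b_tp.Mem tp →
      hg1201E_M19b_n.Mem n → ObsStiffnessSeqCeilingAt tp (U / t) n c := by
  obtain ⟨c, hc, hW⟩ := hg1201E_Ucell_rungs_of_ceiling hle h
  refine ⟨c, hc, fun U t tp n hU ht htp hn => hW U t tp n ?_ ht htp hn⟩
  have ht' := (Entry.mem_ofEnds_iff _ _ _ _ _).1 ht
  push_cast at ht'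
  exact (hg1201E_Ucell_Ureach_iff hlo).2 hU t ht'

/-! ## §G4 The LEVEL-1 ladder census (breakpoints `17/4`, `5`, `7`; numbers only, members of parts 1/5) -/

/-- The EIGHT members whose @0 row is CUT by the level-1 breakpoint `u = 7` (`7/2 < m < 21/5`): cRPA@QSGW `3.7`, cGW+LRFB `3.85`, gMACE δ = 0.2 `3.85`, mRPA@LDA `3.9`,
gMACE δ = 0.1 `3.99`, MACE δ = 0.1 `3.999`, gMACE δ = 0 `4.0`, MACE δ = 0 `4.029` (crossings `t* = m/7`). [folklore] -/
def hg1201U_level1_cut7 : List ℚ :=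
  [hg1201U_sakakibara2017_cRPA_QSGW, hg1201U_hirayama2019_LRFB, hg1201U_moreeArita2024_d02, hg1201U_sakakibara2017_mRPA_LDA,
    hg1201U_moreeArita2024_d01, hg1201U_moree2022_d01, hg1201U_moreeArita2024_d00, hg1201U_moree2022_d00]

/-- The TWO members whose WHOLE @0 row lies in the level-1 cell `[5, 7]` (`3 ≤ m ≤ 7/2`): in-house (D) `3.335`, Nilsson `3.42`. [folklore] -/
def hg1201U_level1_cell57 : List ℚ := [hg1201U_inhouseD20, hg1201U_nilsson2019]

/-- **The cut-at-7 window**: every `hg1201U_level1_cut7` member has `7/2 < m < 21/5`, crossing `t* = m/7 ∈ [37/70, 4029/7000] ⊂ (1/2, 3/5)` (`0.5286 … 0.5756`). [folklore] -/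
theorem hg1201U_level1_cut7_window {m : ℚ} (hm : m ∈ hg1201U_level1_cut7) :
    ((7 / 2 : ℚ) < m ∧ m < 21 / 5) ∧ ((37 / 70 : ℚ) ≤ m / 7 ∧ m / 7 ≤ 4029 / 7000) ∧ ((1 / 2 : ℚ) < m / 7 ∧ m / 7 < 3 / 5) := by
  simp only [hg1201U_level1_cut7, List.mem_cons, List.mem_nil_iff, or_false] at hm
  rcases hm with rfl | rfl | rfl | rfl | rfl | rfl | rfl | rfl <;> refine ⟨⟨?_, ?_⟩, ⟨?_, ?_⟩, ⟨?_, ?_⟩⟩ <;>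
    norm_num [hg1201U_sakakibara2017_cRPA_QSGW, hg1201U_hirayama2019_LRFB, hg1201U_moreeArita2024_d02, hg1201U_sakakibara2017_mRPA_LDA,
      hg1201U_moreeArita2024_d01, hg1201U_moree2022_d01, hg1201U_moreeArita2024_d00, hg1201U_moree2022_d00]

/-- **The `[5, 7]` whole-row window**: `3 ≤ m ≤ 7/2` for in-house (D) and Nilsson (images `[5.558, 6.67]`, `[5.7, 6.84] ⊂ [5, 7]`). [folklore] -/
theorem hg1201U_level1_cell57_window {m : ℚ} (hm : m ∈ hg1201U_level1_cell57) : (3 : ℚ) ≤ m ∧ m ≤ 7 / 2 := by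
  simp only [hg1201U_level1_cell57, List.mem_cons, List.mem_nil_iff, or_false] at hm
  rcases hm with rfl | rfl <;> constructor <;> norm_num [hg1201U_inhouseD20, hg1201U_nilsson2019]

/-- **The three singletons**: Jang `43/20` is cut by `u = 17/4` (`17/8 < 2.15 < 51/20`) at `t* = 43/85 = 0.50588…`; cGW `437/100` has its whole row in `[7, 44/5]`
(`21/5 ≤ 4.37 ≤ 22/5`); mRPA@QSGW `26/5 > 22/5` enters M19b only on the sliver `t_eff ≥ 13/22` (part 6), inside the cell `[7, 44/5]`. [folklore] -/
theorem hg1201U_level1_singletons :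
    ((17 / 8 : ℚ) < hg1201U_jang2016 ∧ hg1201U_jang2016 < 51 / 20 ∧ hg1201U_jang2016 / (17 / 4) = 43 / 85) ∧
    ((21 / 5 : ℚ) ≤ hg1201U_hirayama2018_cGW ∧ hg1201U_hirayama2018_cGW ≤ 22 / 5) ∧
    ((22 / 5 : ℚ) < hg1201U_sakakibara2017_mRPA_QSGW ∧ hg1201U_sakakibara2017_mRPA_QSGW / (44 / 5) = 13 / 22 ∧
      hg1201U_sakakibara2017_mRPA_QSGW / 7 > 3 / 5) := by
  refine ⟨⟨?_, ?_, ?_⟩, ⟨?_, ?_⟩, ⟨?_, ?_, ?_⟩⟩ <;>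
    norm_num [hg1201U_jang2016, hg1201U_hirayama2018_cGW, hg1201U_sakakibara2017_mRPA_QSGW]

/-- **THE LEVEL-1 CENSUS**: every admitted member is exactly one of — Jang (cut at `17/4`) ∣ a part-11 straddler (cut at `5`) ∣ cut at `7` ∣ whole row in `[5, 7]` ∣ cGW
(whole row in `[7, 44/5]`) ∣ mRPA@QSGW (third slab / sliver) — and `1 + 3 + 8 + 2 + 1 + 1 = 16`; the four cells' FULL-`t_eff` eV reaches are `[21/10, 17/8]`, EMPTY
(`3·(17/4)/5 = 51/20 > 5/2`), `[3, 7/2]`, `[21/5, 22/5]`. [folklore] -/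
theorem hg1201E_level1_ladder_census :
    (∀ m ∈ hg1201U_members, m = hg1201U_jang2016 ∨ m ∈ hg1201U_bank5_straddle ∨ m ∈ hg1201U_level1_cut7 ∨ m ∈ hg1201U_level1_cell57 ∨
      m = hg1201U_hirayama2018_cGW ∨ m = hg1201U_sakakibara2017_mRPA_QSGW) ∧
    1 + hg1201U_bank5_straddle.length + hg1201U_level1_cut7.length + hg1201U_level1_cell57.length + 1 + 1 = hg1201U_members.length ∧
    ((3 : ℚ) / 5 * (7 / 2) = 21 / 10 ∧ (17 / 4 : ℚ) / 2 = 17 / 8) ∧ ((5 : ℚ) / 2 < 3 / 5 * (17 / 4)) ∧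
    ((3 : ℚ) / 5 * 5 = 3 ∧ (7 : ℚ) / 2 = 7 / 2) ∧ ((3 : ℚ) / 5 * 7 = 21 / 5 ∧ (44 / 5 : ℚ) / 2 = 22 / 5) := by
  refine ⟨?_, by decide, by norm_num, by norm_num, by norm_num, by norm_num⟩
  simp only [hg1201U_members, hg1201U_bank5_straddle, hg1201U_level1_cut7, hg1201U_level1_cell57, List.mem_cons, List.mem_nil_iff, or_false]
  rintro m (rfl | rfl | rfl | rfl | rfl | rfl | rfl | rfl | rfl | rfl | rfl | rfl | rfl | rfl | rfl | rfl) <;> simp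

/-! ## §G5 The LEVEL-1 readings, cell by cell (what ONE cell's strip certificate certifies on the ladder; CONDITIONAL on that cell's slice ceiling) -/

/-- **CELL `[5, 7]` ALONE** certifies ONE `c ≤ bar`: (i) at every `U ∈ [3, 7/2]` eV — in-house (D) `3.335` and Nilsson `3.42` — at EVERY `t_eff`; (ii) at each of the
eight cut-at-7 members `m` on `t_eff ∈ [m/7, 3/5]`; (iii) at each part-11 straddler `m ∈ {2.865, 2.9462, 2.98}` on `t_eff ∈ [1/2, m/5]` (whole M19b `t′/t`, `n` entries).
CONDITIONAL on the `[5, 7]` slice ceiling. [cite: ScalapinoWhiteZhang1993, §II] -/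
theorem hg1201E_level1_cell57_rungs_of_ceiling {bar : ℚ}
    (h : StiffnessBoxCeilingBelow (boxHg1201E_M19b.withEntry .UOverT (Entry.ofEnds 5 7 (by norm_num) .screening)) bar) :
    ∃ c : ℚ, c ≤ bar ∧
      (∀ U t tp n : ℝ, ((3 : ℝ) ≤ U ∧ U ≤ 7 / 2) → hg1201E_M19b_t.Mem t → hg1201E_M19b_tp.Mem tp → hg1201E_M19b_n.Mem n →
        ObsStiffnessSeqCeilingAt tp (U / t) n c) ∧
      (∀ m ∈ hg1201U_level1_cut7, ∀ t tp n : ℝ, ((m : ℝ) / 7 ≤ t ∧ t ≤ 3 / 5) → hg1201E_M19b_tp.Mem tp → hg1201E_M19b_n.Mem n →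
        ObsStiffnessSeqCeilingAt tp ((m : ℝ) / t) n c) ∧
      (∀ m ∈ hg1201U_bank5_straddle, ∀ t tp n : ℝ, ((1 / 2 : ℝ) ≤ t ∧ t ≤ (m : ℝ) / 5) → hg1201E_M19b_tp.Mem tp → hg1201E_M19b_n.Mem n →
        ObsStiffnessSeqCeilingAt tp ((m : ℝ) / t) n c) := by
  obtain ⟨c, hc, hW⟩ := hg1201E_Ucell_rungs_of_ceiling' _ h
  refine ⟨c, hc, fun U t tp n hU ht htp hn => hW U t tp n ?_ ht htp hn, fun m hm t tp n ht htp hn => ?_, fun m hm t tp n ht htp hn => ?_⟩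
  · have ht' := (Entry.mem_ofEnds_iff _ _ _ _ _).1 ht
    push_cast at ht' ⊢
    constructor <;> linarith [ht'.1, ht'.2, hU.1, hU.2]
  · have hlo : ((7 / 2 : ℚ) : ℝ) < (m : ℝ) := (Rat.cast_lt (K := ℝ)).mpr (hg1201U_level1_cut7_window hm).1.1
    push_cast at hlo
    have ht1 : (1 / 2 : ℝ) ≤ t := by linarith [ht.1]
    have htE : hg1201E_M19b_t.Mem t := (Entry.mem_ofEnds_iff _ _ _ _ _).2 (by push_cast; exact ⟨ht1, ht.2⟩)
    refine hW _ t tp n ⟨?_, ?_⟩ htE htp hn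
    · push_cast; linarith [ht.2]
    · push_cast; have := ht.1; rw [div_le_iff₀ (by norm_num : (0 : ℝ) < 7)] at this; linarith
  · have hhi : (m : ℝ) ≤ ((149 / 50 : ℚ) : ℝ) := (Rat.cast_le (K := ℝ)).mpr (hg1201U_straddle_mem_gap hm).1.2
    push_cast at hhi
    have ht2 : t ≤ (3 / 5 : ℝ) := by linarith [ht.2]
    have htE : hg1201E_M19b_t.Mem t := (Entry.mem_ofEnds_iff _ _ _ _ _).2 (by push_cast; exact ⟨ht.1, ht2⟩)
    refine hW _ t tp n ⟨?_, ?_⟩ htE htp hn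
    · push_cast; have := ht.2; rw [le_div_iff₀ (by norm_num : (0 : ℝ) < 5)] at this; linarith
    · push_cast; linarith [ht.1]

/-- **CELL `[7, 44/5]` ALONE** certifies ONE `c ≤ bar`: (i) at every `U ∈ [21/5, 22/5]` eV — cGW `4.37` — at EVERY `t_eff`; (ii) at each cut-at-7 member `m` on
`t_eff ∈ [1/2, m/7]`; (iii) at the mRPA@QSGW rung `5.2` on the sliver `t_eff ∈ [13/22, 3/5]`. With `hg1201E_level1_cell57_rungs_of_ceiling` (ii) the two cells tile
each cut member's `t_eff` row at `t* = m/7`. CONDITIONAL on the `[7, 44/5]` slice ceiling. [cite: ScalapinoWhiteZhang1993, §II] -/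
theorem hg1201E_level1_cell7top_rungs_of_ceiling {bar : ℚ}
    (h : StiffnessBoxCeilingBelow (boxHg1201E_M19b.withEntry .UOverT (Entry.ofEnds 7 (44 / 5) (by norm_num) .screening)) bar) :
    ∃ c : ℚ, c ≤ bar ∧
      (∀ U t tp n : ℝ, ((21 / 5 : ℝ) ≤ U ∧ U ≤ 22 / 5) → hg1201E_M19b_t.Mem t → hg1201E_M19b_tp.Mem tp → hg1201E_M19b_n.Mem n →
        ObsStiffnessSeqCeilingAt tp (U / t) n c) ∧
      (∀ m ∈ hg1201U_level1_cut7, ∀ t tp n : ℝ, ((1 / 2 : ℝ) ≤ t ∧ t ≤ (m : ℝ) / 7) → hg1201E_M19b_tp.Mem tp → hg1201E_M19b_n.Mem n →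
        ObsStiffnessSeqCeilingAt tp ((m : ℝ) / t) n c) ∧
      (∀ t tp n : ℝ, ((13 / 22 : ℝ) ≤ t ∧ t ≤ 3 / 5) → hg1201E_M19b_tp.Mem tp → hg1201E_M19b_n.Mem n →
        ObsStiffnessSeqCeilingAt tp ((hg1201U_sakakibara2017_mRPA_QSGW : ℝ) / t) n c) := by
  obtain ⟨c, hc, hW⟩ := hg1201E_Ucell_rungs_of_ceiling' _ h
  refine ⟨c, hc, fun U t tp n hU ht htp hn => hW U t tp n ?_ ht htp hn, fun m hm t tp n ht htp hn => ?_, fun t tp n ht htp hn => ?_⟩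
  · have ht' := (Entry.mem_ofEnds_iff _ _ _ _ _).1 ht
    push_cast at ht' ⊢
    constructor <;> linarith [ht'.1, ht'.2, hU.1, hU.2]
  · have hhi : (m : ℝ) < ((21 / 5 : ℚ) : ℝ) := (Rat.cast_lt (K := ℝ)).mpr (hg1201U_level1_cut7_window hm).1.2
    push_cast at hhi
    have ht2 : t ≤ (3 / 5 : ℝ) := by linarith [ht.2]
    have htE : hg1201E_M19b_t.Mem t := (Entry.mem_ofEnds_iff _ _ _ _ _).2 (by push_cast; exact ⟨ht.1, ht2⟩)
    refine hW _ t tp n ⟨?_, ?_⟩ htE htp hn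
    · push_cast; have := ht.2; rw [le_div_iff₀ (by norm_num : (0 : ℝ) < 7)] at this; linarith
    · push_cast; linarith [ht.1]
  · have htE : hg1201E_M19b_t.Mem t := (Entry.mem_ofEnds_iff _ _ _ _ _).2 (by push_cast; exact ⟨by linarith [ht.1], ht.2⟩)
    refine hW _ t tp n ⟨?_, ?_⟩ htE htp hn <;> norm_num [hg1201U_sakakibara2017_mRPA_QSGW] <;> linarith [ht.1, ht.2]

/-- **CELLS `[7/2, 17/4]` AND `[17/4, 5]` ALONE** (the bisected lower segment): the first certifies the Jang rung `2.15` on `t_eff ∈ [43/85, 3/5]` and every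
`U ∈ [21/10, 17/8]` at every `t_eff`; the second certifies Jang on `t_eff ∈ [1/2, 43/85]` and each part-11 straddler `m` on `t_eff ∈ [m/5, 3/5]` (its full-`t`
reach is EMPTY). CONDITIONAL on the respective slice ceilings. [cite: ScalapinoWhiteZhang1993, §II] -/
theorem hg1201E_level1_lowCells_rungs_of_ceilings {bar₁ bar₂ : ℚ} :
    (StiffnessBoxCeilingBelow (boxHg1201E_M19b.withEntry .UOverT (Entry.ofEnds (7 / 2) (17 / 4) (by norm_num) .screening)) bar₁ →
      ∃ c : ℚ, c ≤ bar₁ ∧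
        (∀ t tp n : ℝ, ((43 / 85 : ℝ) ≤ t ∧ t ≤ 3 / 5) → hg1201E_M19b_tp.Mem tp → hg1201E_M19b_n.Mem n →
          ObsStiffnessSeqCeilingAt tp ((hg1201U_jang2016 : ℝ) / t) n c) ∧
        (∀ U t tp n : ℝ, ((21 / 10 : ℝ) ≤ U ∧ U ≤ 17 / 8) → hg1201E_M19b_t.Mem t → hg1201E_M19b_tp.Mem tp → hg1201E_M19b_n.Mem n →
          ObsStiffnessSeqCeilingAt tp (U / t) n c)) ∧
    (StiffnessBoxCeilingBelow (boxHg1201E_M19b.withEntry .UOverT (Entry.ofEnds (17 / 4) 5 (by norm_num) .screening)) bar₂ →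
      ∃ c : ℚ, c ≤ bar₂ ∧
        (∀ t tp n : ℝ, ((1 / 2 : ℝ) ≤ t ∧ t ≤ 43 / 85) → hg1201E_M19b_tp.Mem tp → hg1201E_M19b_n.Mem n →
          ObsStiffnessSeqCeilingAt tp ((hg1201U_jang2016 : ℝ) / t) n c) ∧
        (∀ m ∈ hg1201U_bank5_straddle, ∀ t tp n : ℝ, ((m : ℝ) / 5 ≤ t ∧ t ≤ 3 / 5) → hg1201E_M19b_tp.Mem tp → hg1201E_M19b_n.Mem n →
          ObsStiffnessSeqCeilingAt tp ((m : ℝ) / t) n c)) := by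
  refine ⟨fun h => ?_, fun h => ?_⟩
  · obtain ⟨c, hc, hW⟩ := hg1201E_Ucell_rungs_of_ceiling' _ h
    refine ⟨c, hc, fun t tp n ht htp hn => ?_, fun U t tp n hU ht htp hn => hW U t tp n ?_ ht htp hn⟩
    · have htE : hg1201E_M19b_t.Mem t := (Entry.mem_ofEnds_iff _ _ _ _ _).2 (by push_cast; exact ⟨by linarith [ht.1], ht.2⟩)
      refine hW _ t tp n ⟨?_, ?_⟩ htE htp hn <;> norm_num [hg1201U_jang2016] <;> linarith [ht.1, ht.2]
    · have ht' := (Entry.mem_ofEnds_iff _ _ _ _ _).1 ht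
      push_cast at ht' ⊢
      constructor <;> linarith [ht'.1, ht'.2, hU.1, hU.2]
  · obtain ⟨c, hc, hW⟩ := hg1201E_Ucell_rungs_of_ceiling' _ h
    refine ⟨c, hc, fun t tp n ht htp hn => ?_, fun m hm t tp n ht htp hn => ?_⟩
    · have htE : hg1201E_M19b_t.Mem t := (Entry.mem_ofEnds_iff _ _ _ _ _).2 (by push_cast; exact ⟨ht.1, by linarith [ht.2]⟩)
      refine hW _ t tp n ⟨?_, ?_⟩ htE htp hn <;> norm_num [hg1201U_jang2016] <;> linarith [ht.1, ht.2]
    · have hlo : ((573 / 200 : ℚ) : ℝ) ≤ (m : ℝ) := (Rat.cast_le (K := ℝ)).mpr (hg1201U_straddle_mem_gap hm).1.1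
      push_cast at hlo
      have ht1 : (1 / 2 : ℝ) ≤ t := by linarith [ht.1]
      have htE : hg1201E_M19b_t.Mem t := (Entry.mem_ofEnds_iff _ _ _ _ _).2 (by push_cast; exact ⟨ht1, ht.2⟩)
      refine hW _ t tp n ⟨?_, ?_⟩ htE htp hn
      · push_cast; linarith [ht.2]
      · push_cast; have := ht.1; rw [div_le_iff₀ (by norm_num : (0 : ℝ) < 5)] at this; linarith

/-- **ALL FOUR LEVEL-1 CELLS ⇒ EVERY RUNG** (through the leaf: `Hg1201M19b_StiffnessBoxCeiling_of_level1Strips` + part 7's `hg1201E_ladder_stiffness_of_rungLeaf`):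
ONE `c ≤ 0.5166800` at every v1.8 rung `U ∈ [2.15, 4.37] × t_eff ∈ [1/2, 3/5] × t′/t ∈ [−27/50, −43/100] × n ∈ [167/200, 183/200]`. CONDITIONAL on the four strips.
[cite: ScalapinoWhiteZhang1993, §II] -/
theorem hg1201E_ladder_allRungs_of_level1Strips {c₁ c₂ c₃ c₄ : ℚ} (hc₁ : c₁ ≤ 5166800 / 10000000)
    (hc₂ : c₂ ≤ 5166800 / 10000000) (hc₃ : c₃ ≤ 5166800 / 10000000) (hc₄ : c₄ ≤ 5166800 / 10000000)
    (h₁ : ∀ tp ∈ Icc (-27 / 50 : ℝ) (-13 / 25), ∀ U ∈ Icc (7 / 2 : ℝ) (17 / 4), ∀ n ∈ Icc (179 / 200 : ℝ) (183 / 200), ObsStiffnessSeqCeilingAt tp U n c₁)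
    (h₂ : ∀ tp ∈ Icc (-27 / 50 : ℝ) (-13 / 25), ∀ U ∈ Icc (17 / 4 : ℝ) 5, ∀ n ∈ Icc (179 / 200 : ℝ) (183 / 200), ObsStiffnessSeqCeilingAt tp U n c₂)
    (h₃ : ∀ tp ∈ Icc (-27 / 50 : ℝ) (-13 / 25), ∀ U ∈ Icc (5 : ℝ) 7, ∀ n ∈ Icc (179 / 200 : ℝ) (183 / 200), ObsStiffnessSeqCeilingAt tp U n c₃)
    (h₄ : ∀ tp ∈ Icc (-27 / 50 : ℝ) (-13 / 25), ∀ U ∈ Icc (7 : ℝ) (44 / 5), ∀ n ∈ Icc (179 / 200 : ℝ) (183 / 200), ObsStiffnessSeqCeilingAt tp U n c₄) :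
    ∃ c : ℚ, c ≤ 5166800 / 10000000 ∧ ∀ U t tp n : ℝ, hg1201U_litHullV18.Mem U → hg1201E_M19b_t.Mem t → hg1201E_M19b_tp.Mem tp →
      hg1201E_M19b_n.Mem n → ObsStiffnessSeqCeilingAt tp (U / t) n c :=
  hg1201E_ladder_stiffness_of_rungLeaf (Hg1201M19b_StiffnessBoxCeiling_of_level1Strips hc₁ hc₂ hc₃ hc₄ h₁ h₂ h₃ h₄)

end Summit.Ventures.CertifiedManyBodySolver.Downfold

end
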